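/-
Copyright (c) 2026 the pub-hodgecm-mathlib formalisation cell (harness21).  Prover seat hodgecm-mathlib-LH4-p07 (g4), req620 Track A «(D-RAM) FOUR-FRAME» squad
(heir LEAD F0P3a-plan lineage; dealer LH4-plan lineage WORD #26 (1); MS ROAD A, Stage B₂ brick B7₂ «CORE-HANGING STRATA, TYPE 2», FILE (H1b): the stratum `H(1)`
(`ρ = 0`, axis `(1,1,1)`) — the count `n₂ = q − 2`; Stage B lead LH4-p10 (g2)).  2026-09-04.
-/
import Summits.HodgeConjecture.HodgeConjecture.Theorems.F0P3cDyRamDiagonalCoreHangingRhoZeroTypeTwo   -- (H1a) (this seat): exact Δ₂ and relatedness on `H(1)`; brings (iii)₂(b), ★ Tools, ★ PolarisationCoset, ★ class reps, ★ p856296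
import HarnessLib

/-!
# Crux `H413`, MS ROAD A, STAGE B₂ brick B7₂, FILE (H1b): «THE CORE-HANGING STRATUM `H(1)` (`ρ = 0`) — `polarisationCount σ ϖ 2 (latt W(y,ζ)) = q − 2`»

Cell `hodgecm-mathlib` (D-0151), FLOOR 0, crux item H413 = `stmt-HodgeConjecture-24833`; lane `--supports stmt-HodgeConjecture-24833 --as helper` (count-neutral).  THEOREMS ONLY
(no `def`, no instance, no notation, no `sorry`, default heartbeats).  Continuation of FILE (H1a) `F0P3cDyRamDiagonalCoreHangingRhoZeroTypeTwo` (frame `W(y,ζ) = (1 0 0; 0 1 0; y ζ ϖ)`,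
`y, ζ` units; exact `Δ₂` = fixed unit vectors `D` with the cofactor congruence `(D₀ + NyD₂)(D₁ + NζD₂) ≡ NyNζD₂² (𝔭)`; classes = residue pairs `(D₀∕D₂, D₁∕D₂) mod 𝔭`).
THE COUNT (F0P3-p01 (g31) 2026-09-04T00:59:20Z; LH4-p10 (g2) 01:03:42Z q = 4 data point `n₂(H(1)) = 2`; REF5 R5-78 (C); LH4-r01 (g3) DV): the admissible residue pairs `(ū, w̄)`,
`(ū + Nȳ)(w̄ + Nζ̄) = NȳNζ̄`, `ū, w̄ ≠ 0`, are parametrised by `A := ū + Nȳ ∈ 𝓀 ∖ {0, Nȳ}` — `q − 2` of them.  ASSEMBLY (★ p13 `polarisationCount_eq_card_of_reps`): `reps =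
{D(a) := (a − Ny, −Nζ(a − Ny)∕a, 1)}` for `a` in a complete irredundant system `R₁` of fixed units modulo `𝔭` with `a ≢ Ny` ((H1a): these polarise, the cofactor vanishing EXACTLY);
`hΔ`: a polarisation `D` has `A := D₀∕D₂ + Ny` a UNIT (else `|NyNζ| < 1`), its representative `a ∈ R₁` is `≢ Ny`, and `D ~ D(a)` by (H1a) §2 (`D₀∕D₂ ≡ a − Ny`, `D₁∕D₂ ≡ NyNζ∕a − Nζ`);
`hfree` by (H1a) §2 and irredundance; `#reps = q − 2` (`ncard_reps_sub_unit_eq`).  At `q = 2` the value is `0`: `H(1)` carries no type-2 polarisation there.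
* `ncard_reps_sub_unit_eq` — among the `q − 1` representatives of the fixed units mod `𝔭`, exactly `q − 2` are `≢` a given fixed unit.
* HEAD **`polarisationCount_two_latt_rhoZeroH_eq`**.
HONEST LABEL.  Count-neutral; the census laws stay PROVER TARGETS until the MS assembly lands; `HC_CM` is proved only modulo the 7 printed citations (2 remaining named inputs:
hLiu418 = `stmt-HodgeConjecture-24832`, h413 = `stmt-HodgeConjecture-24833`) until rung 0 closes.

## References
* [Kottwitz1986BaseChangeUnits] R. Kottwitz, *Base change for unit elements of Hecke algebras*, Compositio Math. 60 (1986), §1 pp. 240–241 (counting modulo the torus).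
* [Serre1979] J.-P. Serre, *Local Fields*, GTM 67, Springer (1979), Ch. IV §2 Prop. 6 (`U∕U^{(1)} ≅ 𝓀^×`).
-/

set_option autoImplicit false

noncomputable section

namespace Summit.HodgeConjecture.HodgeConjecture.Cruxes.H413.F0P3cDyRamDiagonalCoreHangingRhoZeroCountTypeTwo
open Matrix
open Literature.NumberTheory.Automorphic Literature.NumberTheory.Automorphic.HermitianLattice Literature.NumberTheory.Automorphic.UnitaryGroup
open Literature.NumberTheory.Automorphic.UnitaryLatticeTree
open Summit.HodgeConjecture.HodgeConjecture.Cruxes.H413.F0P3cDyRamDiagonalTorusDefs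
open Summit.HodgeConjecture.HodgeConjecture.Cruxes.H413.F0P3cDyRamDiagonalStrataDefs
open Summit.HodgeConjecture.HodgeConjecture.Cruxes.H413.F0P3cDyRamDiagonalStableLatticeHNF
open Summit.HodgeConjecture.HodgeConjecture.Cruxes.H413.F0P3cDyRamDiagonalGluedTubeCriterion
open Summit.HodgeConjecture.HodgeConjecture.Cruxes.H413.F0P3cDyRamDiagonalGluedTorusOrbits
open Summit.HodgeConjecture.HodgeConjecture.Cruxes.H413.F0P3cDyRamDiagonalGluedStabiliserIndex
open Summit.HodgeConjecture.HodgeConjecture.Cruxes.H413.F0P3cDyRamDiagonalGluedClassRepresentatives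
open Summit.HodgeConjecture.HodgeConjecture.Cruxes.H413.F0P3cDyRamDiagonalGluedRhoZero
open Summit.HodgeConjecture.HodgeConjecture.Cruxes.H413.F0P3cDyRamDiagonalPolarisationCoset
open Summit.HodgeConjecture.HodgeConjecture.Cruxes.H413.F0P3cDyRamDiagonalPolarisationCountTools
open Summit.HodgeConjecture.HodgeConjecture.Cruxes.H413.F0P3cDyRamDiagonalCoreHangingPolarisationsTypeTwo
open scoped Valued WithZero Matrix MatrixGroups
open Summit.HodgeConjecture.HodgeConjecture.Cruxes.H413.F0P3cDyRamDiagonalCoreHangingRhoZeroTypeTwo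

variable {K : Type*} [Field K] [Valued K ℤᵐ⁰]

/-! ## §3  The count `n₂ = q − 2` -/

/-- **AMONG THE `q − 1` REPRESENTATIVES OF THE FIXED UNITS MODULO `𝔭`, EXACTLY `q − 2` ARE NOT CONGRUENT TO A GIVEN FIXED UNIT `g`** (the one congruent to `g` exists by
completeness and is unique by irredundance; `|t| < 1 ⇒ |t| ≤ |ϖ|` by discreteness). [cite: Serre1979, Ch. IV §2 Prop. 6] -/
theorem ncard_reps_sub_unit_eq {σ : K →+* K} {ϖ : K} (hϖ : Valued.v ϖ = WithZero.exp (-1 : ℤ)) {R : Set K} (hRcard : R.ncard = Nat.card 𝓀[K] - 1)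
    (hR1 : ∀ g ∈ R, σ g = g ∧ Valued.v g = 1) (hR2 : ∀ f : K, σ f = f → Valued.v f = 1 → ∃ g ∈ R, Valued.v (f - g) ≤ Valued.v ϖ ^ 1)
    (hR3 : ∀ g ∈ R, ∀ g' ∈ R, Valued.v (g - g') ≤ Valued.v ϖ ^ 1 → g = g') {g : K} (hσg : σ g = g) (hvg : Valued.v g = 1) :
    {a ∈ R | Valued.v (a - g) = 1}.ncard = Nat.card 𝓀[K] - 2 := by
  classical
  obtain ⟨-, hϖ1⟩ := ne_zero_and_v_lt_one_of_v_eq_exp hϖ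
  -- discreteness: `|t| < 1 → |t| ≤ |ϖ|`
  have hdisc : ∀ t : K, Valued.v t < 1 → Valued.v t ≤ Valued.v ϖ := fun t ht => by
    rcases eq_or_ne (Valued.v t) 0 with h0 | h0
    · rw [h0]; exact zero_le
    · rw [← WithZero.exp_log h0, hϖ, WithZero.exp_le_exp]
      rw [← WithZero.exp_log h0, ← WithZero.exp_zero, WithZero.exp_lt_exp] at ht
      omega
  obtain ⟨a₀, ha₀R, ha₀⟩ := hR2 g hσg hvg
  rw [pow_one] at ha₀
  -- `{|a − g| = 1} = R ∖ {a₀}`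
  have hset : {a ∈ R | Valued.v (a - g) = 1} = R \ {a₀} := by
    ext a
    simp only [Set.mem_setOf_eq, Set.mem_sdiff, Set.mem_singleton_iff]
    constructor
    · rintro ⟨haR, ha⟩
      refine ⟨haR, fun h => ?_⟩
      rw [h, Valuation.map_sub_swap] at ha
      rw [ha] at ha₀
      exact absurd ha₀ (not_le.2 hϖ1)
    · rintro ⟨haR, hne⟩
      have hle : Valued.v (a - g) ≤ 1 := Valuation.map_sub_le _ (hR1 a haR).2.le hvg.le
      refine ⟨haR, le_antisymm hle (not_lt.1 fun hlt => hne (hR3 a haR a₀ ha₀R ?_))⟩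
      rw [pow_one, show a - a₀ = (a - g) + (g - a₀) by ring]
      exact Valuation.map_add_le _ (hdisc _ hlt) ha₀
  rw [hset, Set.ncard_sdiff (Set.singleton_subset_iff.2 ha₀R) (Set.finite_singleton _), hRcard, Set.ncard_singleton]
  omega

/-- **B7₂, `H(1)` — `polarisationCount σ ϖ 2 (latt W(y,ζ)) = q − 2`** for units `y, ζ` over the ramified quadratic datum (`σ` involution, `v ∘ σ = v`, fixed elements of even
valuation, `|ϖ| = exp(−1)`, `|ϖ − σϖ| = |ϖ|^d`, finite residue field).  ASSEMBLY (★ p13 `polarisationCount_eq_card_of_reps`): `reps = {D(a) := (a − Ny, −Nζ(a − Ny)∕a, 1)}` for `a`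
in a complete irredundant system `R₁` of fixed units modulo `𝔭` with `a ≢ Ny` (§1: these polarise, the cofactor vanishing EXACTLY); `hΔ`: a polarisation `D` has `A := D₀∕D₂ + Ny` a
unit (else `|NyNζ| < 1`), its representative `a ∈ R₁` is `≢ Ny`, and `D ~ D(a)` by §2 (`D₀∕D₂ ≡ a − Ny`, `D₁∕D₂ ≡ NyNζ∕a − Nζ`); `hfree` by §2 and irredundance; `#reps = q − 2`
(`ncard_reps_sub_unit_eq`).  At `q = 2` the value is `0`: `H(1)` carries no type-2 polarisation (LH4-p10 (g2) ∕ LH4-r01 (g3): the axis `(1,1,1)` never appears among the polarisable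
frames of a `q = 2` cell). [cite: Kottwitz1986BaseChangeUnits, §1 pp. 240–241] [cite: Serre1979, Ch. IV §2 Prop. 6] -/
theorem polarisationCount_two_latt_rhoZeroH_eq {σ : K →+* K} {ϖ : K} {d : ℕ} (hσ : ∀ a, σ (σ a) = a) (hvσ : ∀ a, Valued.v (σ a) = Valued.v a)
    (hfix : ∀ x : K, σ x = x → x ≠ 0 → ∃ n : ℤ, Valued.v x = WithZero.exp (2 * n)) (hϖ : Valued.v ϖ = WithZero.exp (-1 : ℤ))
    (hd : Valued.v (ϖ - σ ϖ) = Valued.v ϖ ^ d) [Finite 𝓀[K]] {y ζ : K} (hy : Valued.v y = 1) (hζ : Valued.v ζ = 1)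
    (W : GL (Fin 3) K) (hW : (W : Matrix (Fin 3) (Fin 3) K) = !![1, 0, 0; 0, 1, 0; y, ζ, ϖ]) :
    polarisationCount σ ϖ 2 (latt (W : Matrix (Fin 3) (Fin 3) K)) = Nat.card 𝓀[K] - 2 := by
  classical
  obtain ⟨hϖ0, hϖ1⟩ := ne_zero_and_v_lt_one_of_v_eq_exp hϖ
  have hvϖ : 0 < Valued.v ϖ := (Valuation.pos_iff _).2 hϖ0
  -- the fixed units `Ny`, `Nζ`
  set Ny : K := σ y * y with hNy
  set Nζ : K := σ ζ * ζ with hNζ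
  have hσNy : σ Ny = Ny := by rw [hNy, map_mul, hσ, mul_comm]
  have hσNζ : σ Nζ = Nζ := by rw [hNζ, map_mul, hσ, mul_comm]
  have hvNy : Valued.v Ny = 1 := by rw [hNy, map_mul, hvσ, hy, one_mul]
  have hvNζ : Valued.v Nζ = 1 := by rw [hNζ, map_mul, hvσ, hζ, one_mul]
  have hNy0 : Ny ≠ 0 := fun h => by rw [h, map_zero] at hvNy; exact zero_ne_one hvNy
  have hNζ0 : Nζ ≠ 0 := fun h => by rw [h, map_zero] at hvNζ; exact zero_ne_one hvNζ
  -- representatives of the fixed units modulo `𝔭`, and those `≢ Ny`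
  obtain ⟨R, hRfin, hRcard, hR1, hR2, hR3⟩ := exists_fixed_class_representatives hσ hvσ hfix hϖ hd 1 0 le_rfl
  simp only [Nat.mul_zero, pow_zero, Nat.add_zero] at hR1 hR2 hR3
  have hRcard' : R.ncard = Nat.card 𝓀[K] - 1 := by rw [hRcard]; simp
  set R₁ : Set K := {a ∈ R | Valued.v (a - Ny) = 1} with hR₁
  have hR₁fin : R₁.Finite := hRfin.subset (Set.sep_subset _ _)
  have hcount : R₁.ncard = Nat.card 𝓀[K] - 2 := ncard_reps_sub_unit_eq hϖ hRcard' hR1 hR2 hR3 hσNy hvNy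
  -- the explicit forms
  let Dm : K → Fin 3 → K := fun a => ![a - Ny, -(Nζ * (a - Ny)) / a, 1]
  have hDm0 : ∀ a, Dm a 0 = a - Ny := fun _ => rfl
  have hDm1 : ∀ a, Dm a 1 = -(Nζ * (a - Ny)) / a := fun _ => rfl
  have hDm2 : ∀ a, Dm a 2 = 1 := fun _ => rfl
  have hform : ∀ a ∈ R₁, (∀ i, σ (Dm a i) = Dm a i ∧ Dm a i ≠ 0) ∧ (∀ i, Valued.v (Dm a i) = 1) ∧
      IsVertexLattice σ ϖ (Matrix.diagonal (Dm a)) 2 (latt (W : Matrix (Fin 3) (Fin 3) K)) := by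
    rintro a ⟨haR, ha⟩
    obtain ⟨hσa, hva⟩ := hR1 a haR
    have ha0 : a ≠ 0 := fun h => by rw [h, map_zero] at hva; exact zero_ne_one hva
    have hv1 : Valued.v (-(Nζ * (a - Ny)) / a) = 1 := by rw [map_div₀, Valuation.map_neg, map_mul, hvNζ, ha, hva, one_mul, div_one]
    have hvD : ∀ i, Valued.v (Dm a i) = 1 := by
      intro i; fin_cases i
      · exact ha
      · exact hv1
      · exact map_one _
    refine ⟨fun i => ⟨?_, fun h => ?_⟩, hvD, isVertexLattice_two_latt_rhoZeroH_of hvσ hϖ0 hϖ1.le hy hζ W hW hvD ?_⟩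
    · fin_cases i
      · change σ (a - Ny) = a - Ny
        rw [map_sub, hσa, hσNy]
      · change σ (-(Nζ * (a - Ny)) / a) = -(Nζ * (a - Ny)) / a
        rw [map_div₀, map_neg, map_mul, hσNζ, map_sub, hσa, hσNy]
      · change σ 1 = 1
        exact map_one σ
    · have h1 := hvD i
      rw [h, map_zero] at h1
      exact zero_ne_one h1
    · have e : (Dm a 0 + σ y * y * Dm a 2) * (Dm a 1 + σ ζ * ζ * Dm a 2) - σ y * y * (σ ζ * ζ) * Dm a 2 ^ 2 = 0 := by
        rw [hDm0, hDm1, hDm2, ← hNy, ← hNζ]; field_simp; ring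
      rw [e, map_zero]; exact zero_le
  -- the representative set
  let reps : Finset (Fin 3 → K) := hR₁fin.toFinset.image Dm
  have hmem_reps : ∀ {D₁ : Fin 3 → K}, D₁ ∈ reps ↔ ∃ a ∈ R₁, Dm a = D₁ := fun {D₁} => by
    simp only [reps, Finset.mem_image, Set.Finite.mem_toFinset]
  have hinj : Set.InjOn Dm R₁ := fun a _ a' _ h => by
    have h0 := congrFun h 0
    rwa [hDm0, hDm0, sub_left_inj] at h0
  have hcard : reps.card = Nat.card 𝓀[K] - 2 := by
    rw [Finset.card_image_of_injOn (by simpa only [Set.Finite.coe_toFinset] using hinj), ← Set.ncard_eq_toFinset_card R₁ hR₁fin, hcount]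
  rw [← hcard]
  refine polarisationCount_eq_card_of_reps reps (fun D₁ hD₁ => ?_) (fun D hD => ⟨fun hvert => ?_, ?_⟩) (fun D₁ hD₁ D₂ hD₂ u hu hDu => ?_)
  · obtain ⟨a, ha, rfl⟩ := hmem_reps.1 hD₁
    exact (hform a ha).1
  · -- `hΔ` ⟹
    obtain ⟨hvD, hcof⟩ := letters_of_isVertexLattice_two_latt_rhoZeroH hvσ hfix hϖ hy hζ W hW hD hvert
    have hDne : ∀ i, D i ≠ 0 := fun i => (hD i).2
    have hD2 := hDne 2
    set u : K := D 0 / D 2 with hu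
    set w : K := D 1 / D 2 with hw
    have hσu : σ u = u := by rw [hu, map_div₀, (hD 0).1, (hD 2).1]
    have hvu : Valued.v u = 1 := by rw [hu, map_div₀, hvD 0, hvD 2, div_one]
    have hvw : Valued.v w = 1 := by rw [hw, map_div₀, hvD 1, hvD 2, div_one]
    set A : K := u + Ny with hA
    have hσA : σ A = A := by rw [hA, map_add, hσu, hσNy]
    -- the cofactor in `(u, w)`-letters
    have hcof' : Valued.v (A * (w + Nζ) - Ny * Nζ) ≤ Valued.v ϖ := by
      have e : (D 0 + σ y * y * D 2) * (D 1 + σ ζ * ζ * D 2) - σ y * y * (σ ζ * ζ) * D 2 ^ 2 = D 2 ^ 2 * (A * (w + Nζ) - Ny * Nζ) := by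
        rw [hA, hu, hw, ← hNy, ← hNζ]; field_simp
      rw [e, map_mul, map_pow, hvD 2, one_pow, one_mul] at hcof
      exact hcof
    -- `A` is a unit
    have hvA : Valued.v A = 1 := by
      have hle : Valued.v A ≤ 1 := Valuation.map_add_le _ hvu.le hvNy.le
      refine le_antisymm hle (not_lt.1 fun hlt => ?_)
      have h1 : Valued.v (A * (w + Nζ)) < 1 := by
        rw [map_mul]
        calc Valued.v A * Valued.v (w + Nζ) ≤ Valued.v A * 1 := mul_le_mul_right (Valuation.map_add_le _ hvw.le hvNζ.le) _
          _ < 1 := by rw [mul_one]; exact hlt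
      have h2 : Valued.v (Ny * Nζ) < 1 := by
        rw [show Ny * Nζ = A * (w + Nζ) - (A * (w + Nζ) - Ny * Nζ) by ring]
        exact (Valuation.map_sub _ _ _).trans_lt (max_lt h1 (hcof'.trans_lt hϖ1))
      rw [map_mul, hvNy, hvNζ, mul_one] at h2
      exact lt_irrefl _ h2
    have hA0 : A ≠ 0 := fun h => by rw [h, map_zero] at hvA; exact zero_ne_one hvA
    -- the representative of `A`
    obtain ⟨a, haR, hAa⟩ := hR2 A hσA hvA
    rw [pow_one] at hAa
    obtain ⟨-, hva⟩ := hR1 a haR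
    have ha0 : a ≠ 0 := fun h => by rw [h, map_zero] at hva; exact zero_ne_one hva
    have ha₁ : a ∈ R₁ := by
      refine ⟨haR, ?_⟩
      rw [show a - Ny = u + -(A - a) by rw [hA]; ring, Valuation.map_add_eq_of_lt_left _ (by rw [Valuation.map_neg, hvu]; exact hAa.trans_lt hϖ1), hvu]
    obtain ⟨hDa, -, hverta⟩ := hform a ha₁
    have h0 : Valued.v (Dm a 0 / Dm a 2 - D 0 / D 2) ≤ Valued.v ϖ := by
      rw [hDm0, hDm2, div_one, ← hu, show a - Ny - u = -(A - a) by rw [hA]; ring, Valuation.map_neg]; exact hAa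
    have h1 : Valued.v (Dm a 1 / Dm a 2 - D 1 / D 2) ≤ Valued.v ϖ := by
      rw [hDm1, hDm2, div_one, ← hw]
      have e : -(Nζ * (a - Ny)) / a - w = -(((A * (w + Nζ) - Ny * Nζ) * a + Ny * Nζ * (a - A)) / (A * a)) := by
        field_simp; ring
      rw [e, Valuation.map_neg, map_div₀, map_mul, hvA, hva, mul_one, div_one]
      refine Valuation.map_add_le _ ?_ ?_
      · rw [map_mul, hva, mul_one]; exact hcof'
      · rw [map_mul, map_mul, hvNy, hvNζ, one_mul, one_mul, Valuation.map_sub_swap]; exact hAa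
    obtain ⟨v, hv, hDv⟩ := (exists_mem_fixedUnitStabilizer_rhoZeroH_iff hvσ hfix hϖ hy hζ W hW hDa hverta hD hvert).2 ⟨h0, h1⟩
    exact ⟨Dm a, hmem_reps.2 ⟨a, ha₁, rfl⟩, v, hv, hDv⟩
  · -- `hΔ` ⟸
    rintro ⟨D₁, hD₁, u, hu, hDu⟩
    obtain ⟨a, ha, rfl⟩ := hmem_reps.1 hD₁
    have hfun : (fun i => Dm a i * (u i : K)) = D := funext fun i => (hDu i).symm
    exact hfun ▸ isVertexLattice_diagonal_mul_of_mem_fixedUnitStabilizer σ (hform a ha).2.2 hu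
  · -- `hfree`
    obtain ⟨a, ha, rfl⟩ := hmem_reps.1 hD₁
    obtain ⟨a', ha', rfl⟩ := hmem_reps.1 hD₂
    obtain ⟨hDa, -, hverta⟩ := hform a ha
    obtain ⟨hDa', -, hverta'⟩ := hform a' ha'
    obtain ⟨h0, -⟩ := (exists_mem_fixedUnitStabilizer_rhoZeroH_iff hvσ hfix hϖ hy hζ W hW hDa hverta hDa' hverta').1 ⟨u, hu, hDu⟩
    rw [hDm0, hDm0, hDm2, hDm2, div_one, div_one, show a - Ny - (a' - Ny) = a - a' by ring, ← pow_one (Valued.v ϖ)] at h0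
    rw [hR3 a ha.1 a' ha'.1 h0]

end Summit.HodgeConjecture.HodgeConjecture.Cruxes.H413.F0P3cDyRamDiagonalCoreHangingRhoZeroCountTypeTwo

end
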